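import Literature.Combinatorics.Extremal.RuledSurfaceLines
import Literature.RingTheory.MvPolynomial.PlaneCurvesWeakBezout
import HarnessLib

/-!
# Crossing points of lines on a ruled surface (Salmon's pencil argument, algebraic form)

Topic `Literature/Combinatorics/Extremal`. The key lemma of the classical theory of ruled surfaces
in the form used by incidence geometry ([GuthKatz2015, Lemma 3.4, proof: "we repeat an argument
found in [Salm] Art 485"]; [Kollar2015, Proposition 55 (5)]): on an irreducible surface
`S = {f = 0} ⊂ K³` of degree `d` over an algebraically closed field, every point of which lies on
a line of `S`, a line `ℓ ⊂ S` which is coplanar with only finitely many lines of `S` contains at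
most `d - 1` points lying on other such lines (`card_crossing_le_of_axis`, for `ℓ` the
`x₂`-axis; the general case is obtained by an affine change of coordinates in
`RuledSurfaceCrossingBound.lean`).

The printed argument: choose a plane `Π ⊃ ℓ`; `Π ∩ S = ℓ ∪ C` with `deg C = d - 1`; if another
generator `m` meets `ℓ` at `q` then the generators near `m` meet `Π` near `q` and off `ℓ`, hence
on `C`, so `q ∈ C` by a limiting argument. Here: `ℓ` is the axis `{x₀ = x₁ = 0}`, `k ≥ 1` the
order of `f` along it (`axisOrd`), `Π_μ = {x₁ = μ x₀}`, and `f(x₀, μ x₀, x₂) = x₀ᵏ R_μ(x₀, x₂)`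
(`resid`, `pow_mul_eval_resid`); the residual curve meets the axis in the zeros of
`φ_μ = R_μ(0, ·)` (`axisPoly`), a nonzero polynomial of degree `≤ d - k` for all but finitely many
`μ`. The limiting argument is replaced by the elimination theorem
(`Literature.RingTheory.MvPolynomial.exists_eval_ne_zero_not_hasCommonZero`) applied, at a general
point `p₀` of `m`, to the Taylor forms of `f` together with the form `G_μ(p; w)`
(`crossForm`) expressing "the line `(p, w)` meets `Π_μ` on the residual curve", along an
irreducible plane section of `S` through `p₀` (weak Bézout for plane curves,
`Literature.RingTheory.MvPolynomial.PlaneCurves.dvd_of_infinite_commonZeros`): the conclusion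
`G_μ(p₀; u) = 0` for the direction `u` of `m` says exactly `φ_μ(q₂) = 0`
(`axisPoly_eval_eq_zero_of_crossing`). Lines parallel to `Π_μ` need no separate treatment: for
them `G_μ` reduces to the top form of `f`, which vanishes on every direction of a line of `S`.

## References
* [GuthKatz2015] L. Guth, N. H. Katz, Ann. of Math. 181 (2015), §3, Lemma 3.4 and its proof.
* [Kollar2015] J. Kollár, Adv. Math. 271 (2015), §7, Proposition 55 (5).
* G. Salmon, *A Treatise on the Analytic Geometry of Three Dimensions*, 5th ed., Art. 485.
-/

namespace Literature.Combinatorics.Extremal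

open MvPolynomial Finset
open scoped Matrix Polynomial
open Literature.Combinatorics.Additive.DeZeeuw (eq_of_mem_of_mem exists_eval_ne_zero)
open Literature.RingTheory.MvPolynomial (HasCommonZero exists_eval_ne_zero_not_hasCommonZero
  finsuppDegree_eq_univ_sum eval_smul_of_isHomogeneous)
open Literature.Computability.AlgebraicComplexity.DeterminantalConormal (eval_aeval_eq_eval)

section Axis

variable {K : Type*} [Field K]

/-! ### The order of `f` along the axis and the residual polynomials -/

/-- The order of vanishing of `f` along the axis `{x₀ = x₁ = 0}`: the least `e₀ + e₁` over the
monomials `x^e` of `f` (`0` for `f = 0`). [folklore] -/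
noncomputable def axisOrd (f : MvPolynomial (Fin 3) K) : ℕ :=
  if h : f.support.Nonempty then f.support.inf' h (fun e => e 0 + e 1) else 0

/-- Every monomial of `f` has `e₀ + e₁ ≥ axisOrd f`. [folklore] -/
theorem axisOrd_le {f : MvPolynomial (Fin 3) K} {e : Fin 3 →₀ ℕ} (he : e ∈ f.support) :
    axisOrd f ≤ e 0 + e 1 := by
  unfold axisOrd
  rw [dif_pos ⟨e, he⟩]
  exact Finset.inf'_le (s := f.support) (f := fun e : Fin 3 →₀ ℕ => e 0 + e 1) he

/-- The order is attained. [folklore] -/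
theorem exists_mem_support_eq_axisOrd {f : MvPolynomial (Fin 3) K} (hf : f ≠ 0) :
    ∃ e ∈ f.support, e 0 + e 1 = axisOrd f := by
  have h : f.support.Nonempty := by
    rw [Finset.nonempty_iff_ne_empty, Ne, support_eq_empty]; exact hf
  unfold axisOrd
  rw [dif_pos h]
  obtain ⟨e, he, h'⟩ := Finset.exists_mem_eq_inf' h (fun e : Fin 3 →₀ ℕ => e 0 + e 1)
  exact ⟨e, he, h'.symm⟩

/-- The degree of an exponent of `Fin 3`. [folklore] -/
theorem finsuppDegree_fin_three (e : Fin 3 →₀ ℕ) : e.degree = e 0 + e 1 + e 2 := by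
  rw [finsuppDegree_eq_univ_sum, Fin.sum_univ_three]

/-- If the axis lies on `{f = 0}` (`K` infinite) then `axisOrd f ≥ 1`. [folklore] -/
theorem one_le_axisOrd [Infinite K] {f : MvPolynomial (Fin 3) K} (hf : f ≠ 0)
    (haxis : ∀ t : K, eval (Pi.single (2 : Fin 3) t) f = 0) : 1 ≤ axisOrd f := by
  classical
  obtain ⟨e, he, hek⟩ := exists_mem_support_eq_axisOrd hf
  rw [← hek]
  by_contra hlt
  have he0 : e 0 = 0 := by omega
  have he1 : e 1 = 0 := by omega
  -- the restriction of `f` to the axis, as a polynomial in `t`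
  set P : K[X] := ∑ d ∈ f.support, Polynomial.C (coeff d f * 0 ^ (d 0) * 0 ^ (d 1)) *
    Polynomial.X ^ (d 2) with hP
  have hPeval : ∀ t : K, P.eval t = eval (Pi.single (2 : Fin 3) t) f := by
    intro t
    rw [eval_eq', hP, Polynomial.eval_finsetSum]
    refine Finset.sum_congr rfl fun d _ => ?_
    simp only [Polynomial.eval_mul, Polynomial.eval_C, Polynomial.eval_pow, Polynomial.eval_X,
      Fin.prod_univ_three]
    simp
    ring
  have hP0 : P = 0 := Polynomial.funext fun t => by rw [hPeval, haxis, Polynomial.eval_zero]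
  have hcoeff : P.coeff (e 2) = coeff e f := by
    rw [hP, Polynomial.finsetSum_coeff, Finset.sum_eq_single e]
    · simp [he0, he1]
    · intro d hd hde
      simp only [Polynomial.coeff_C_mul, Polynomial.coeff_X_pow]
      by_cases h2 : e 2 = d 2
      · -- then `d₀ > 0` or `d₁ > 0`
        have : d 0 ≠ 0 ∨ d 1 ≠ 0 := by
          by_contra h
          push Not at h
          apply hde
          ext i; fin_cases i
          · simp [h.1, he0]
          · simp [h.2, he1]
          · simp [h2]
        rcases this with h0 | h1
        · rw [zero_pow h0]; simp
        · rw [zero_pow h1]; simp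
      · rw [if_neg h2, mul_zero]
    · intro h; exact absurd he h
  rw [hP0, Polynomial.coeff_zero] at hcoeff
  exact (mem_support_iff.1 he) hcoeff.symm

/-- If `axisOrd f ≥ deg f` then `f` does not involve `x₂`: the surface is a cylinder in the
direction of the axis. [folklore] -/
theorem eval_add_smul_single_of_totalDegree_le_axisOrd {f : MvPolynomial (Fin 3) K}
    (h : f.totalDegree ≤ axisOrd f) (p : Fin 3 → K) (t : K) :
    eval (p + t • Pi.single (2 : Fin 3) 1) f = eval p f := by
  classical
  have he2 : ∀ e ∈ f.support, e 2 = 0 := by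
    intro e he
    have h1 := axisOrd_le he
    have h2 : e.degree ≤ f.totalDegree := le_totalDegree he
    rw [finsuppDegree_fin_three] at h2
    omega
  rw [eval_eq', eval_eq']
  refine Finset.sum_congr rfl fun e he => ?_
  rw [Fin.prod_univ_three, Fin.prod_univ_three, he2 e he, pow_zero, pow_zero]
  simp

/-- The residual polynomial `R_μ(x₀, x₂) = f(x₀, μ x₀, x₂) / x₀ᵏ` (variables `0 ↦ x₀`, `1 ↦ x₂`).
[cite: GuthKatz2015, Lemma 3.4 (proof: "the other component is an algebraic curve c of
degree N-1")] -/
noncomputable def resid (f : MvPolynomial (Fin 3) K) (k : ℕ) (μ : K) : MvPolynomial (Fin 2) K :=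
  ∑ e ∈ f.support, C (coeff e f * μ ^ (e 1)) * X 0 ^ (e 0 + e 1 - k) * X 1 ^ (e 2)

/-- `x₀ᵏ R_μ(x₀, x₂) = f(x₀, μ x₀, x₂)`. [folklore] -/
theorem pow_mul_eval_resid {f : MvPolynomial (Fin 3) K} {k : ℕ}
    (hk : ∀ e ∈ f.support, k ≤ e 0 + e 1) (μ x z : K) :
    x ^ k * eval ![x, z] (resid f k μ) = eval ![x, μ * x, z] f := by
  rw [resid, map_sum, Finset.mul_sum, eval_eq']
  refine Finset.sum_congr rfl fun e he => ?_
  simp only [map_mul, map_pow, eval_C, eval_X, Matrix.cons_val_zero, Matrix.cons_val_one,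
    Fin.prod_univ_three, Matrix.cons_val]
  have hx : x ^ (e 0) * x ^ (e 1) = x ^ k * x ^ (e 0 + e 1 - k) := by
    rw [← pow_add, ← pow_add, Nat.add_sub_cancel' (hk e he)]
  have : x ^ e 0 * (μ * x) ^ e 1 * z ^ e 2 = μ ^ e 1 * (x ^ k * x ^ (e 0 + e 1 - k)) * z ^ e 2 := by
    rw [← hx, mul_pow]; ring
  rw [this]; ring

/-- The trace of the residual curve on the axis: `φ_μ(x₂) = R_μ(0, x₂)`. [folklore] -/
noncomputable def axisPoly (f : MvPolynomial (Fin 3) K) (k : ℕ) (μ : K) : K[X] :=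
  ∑ e ∈ f.support.filter (fun e => e 0 + e 1 = k),
    Polynomial.C (coeff e f * μ ^ (e 1)) * Polynomial.X ^ (e 2)

/-- `R_μ(0, z) = φ_μ(z)`. [folklore] -/
theorem eval_resid_axis {f : MvPolynomial (Fin 3) K} {k : ℕ}
    (hk : ∀ e ∈ f.support, k ≤ e 0 + e 1) (μ z : K) :
    eval ![0, z] (resid f k μ) = (axisPoly f k μ).eval z := by
  rw [resid, map_sum, axisPoly, Finset.sum_filter, Polynomial.eval_finsetSum]
  refine Finset.sum_congr rfl fun e he => ?_
  by_cases h : e 0 + e 1 = k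
  · rw [if_pos h]
    simp [h]
  · rw [if_neg h, Polynomial.eval_zero]
    have hpos : e 0 + e 1 - k ≠ 0 := by have := hk e he; omega
    simp [zero_pow hpos]

/-- `deg φ_μ ≤ d - k`. [folklore] -/
theorem natDegree_axisPoly_le (f : MvPolynomial (Fin 3) K) (k : ℕ) (μ : K) :
    (axisPoly f k μ).natDegree ≤ f.totalDegree - k := by
  refine Polynomial.natDegree_sum_le_of_forall_le _ _ fun e he => ?_
  rw [Finset.mem_filter] at he
  refine (Polynomial.natDegree_C_mul_le _ _).trans ((Polynomial.natDegree_pow_le_of_le _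
    Polynomial.natDegree_X_le).trans ?_)
  have h2 : e.degree ≤ f.totalDegree := le_totalDegree he.1
  rw [finsuppDegree_fin_three] at h2
  omega

/-- The `μ`-polynomial computing the `j`-th coefficient of `φ_μ`. [folklore] -/
noncomputable def axisCoeffPoly (f : MvPolynomial (Fin 3) K) (k j : ℕ) : K[X] :=
  ∑ e ∈ f.support.filter (fun e => e 0 + e 1 = k ∧ e 2 = j),
    Polynomial.C (coeff e f) * Polynomial.X ^ (e 1)

/-- `coeff_j φ_μ = axisCoeffPoly(μ)`. [folklore] -/
theorem coeff_axisPoly (f : MvPolynomial (Fin 3) K) (k : ℕ) (μ : K) (j : ℕ) :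
    (axisPoly f k μ).coeff j = (axisCoeffPoly f k j).eval μ := by
  rw [axisPoly, axisCoeffPoly, Polynomial.finsetSum_coeff, Polynomial.eval_finsetSum,
    Finset.sum_filter, Finset.sum_filter]
  refine Finset.sum_congr rfl fun e _ => ?_
  by_cases h : e 0 + e 1 = k
  · rw [if_pos h]
    by_cases h2 : e 2 = j
    · rw [if_pos ⟨h, h2⟩, Polynomial.coeff_C_mul_X_pow, if_pos h2.symm, Polynomial.eval_mul,
        Polynomial.eval_C, Polynomial.eval_pow, Polynomial.eval_X]
    · rw [if_neg (fun h' => h2 h'.2), Polynomial.coeff_C_mul_X_pow, if_neg (Ne.symm h2)]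
  · rw [if_neg h, if_neg (fun h' => h h'.1)]

/-- For a monomial `x^e` of `f` of axis order `k`, the `μ`-polynomial of index `e₂` is non-zero.
[folklore] -/
theorem axisCoeffPoly_ne_zero {f : MvPolynomial (Fin 3) K} {k : ℕ} {e : Fin 3 →₀ ℕ}
    (he : e ∈ f.support) (hek : e 0 + e 1 = k) : axisCoeffPoly f k (e 2) ≠ 0 := by
  intro h0
  have hc : (axisCoeffPoly f k (e 2)).coeff (e 1) = coeff e f := by
    rw [axisCoeffPoly, Polynomial.finsetSum_coeff, Finset.sum_eq_single e]
    · simp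
    · intro d hd hde
      rw [Finset.mem_filter] at hd
      rw [Polynomial.coeff_C_mul, Polynomial.coeff_X_pow, if_neg, mul_zero]
      intro h1
      apply hde
      ext i; fin_cases i
      · show d 0 = e 0; omega
      · exact h1.symm
      · exact hd.2.2
    · intro hne
      exact absurd (Finset.mem_filter.2 ⟨he, hek, rfl⟩) hne
  rw [h0, Polynomial.coeff_zero] at hc
  exact (mem_support_iff.1 he) hc.symm

/-- `φ_μ ≠ 0` whenever `μ` is not a root of that `μ`-polynomial. [folklore] -/
theorem axisPoly_ne_zero {f : MvPolynomial (Fin 3) K} {k : ℕ} {e : Fin 3 →₀ ℕ} {μ : K}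
    (hμ : ¬ (axisCoeffPoly f k (e 2)).IsRoot μ) : axisPoly f k μ ≠ 0 := by
  intro h0
  apply hμ
  rw [Polynomial.IsRoot.def, ← coeff_axisPoly, h0, Polynomial.coeff_zero]

/-! ### The cleared incidence form `G_μ(p; w)` -/

/-- `δ(w) = w₁ - μ w₀`, as a linear form in `w` with constant coefficients. [folklore] -/
noncomputable def deltaForm (μ : K) : MvPolynomial (Fin 3) (MvPolynomial (Fin 3) K) :=
  X 1 - C (C μ) * X 0

/-- `ρ(p) = p₁ - μ p₀`. [folklore] -/
noncomputable def rhoPoly (μ : K) : MvPolynomial (Fin 3) K := X 1 - C μ * X 0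

/-- `x̂(p; w) = δ(w) p₀ - ρ(p) w₀`. [folklore] -/
noncomputable def xHat (μ : K) : MvPolynomial (Fin 3) (MvPolynomial (Fin 3) K) :=
  deltaForm μ * C (X 0) - C (rhoPoly μ) * X 0

/-- `ẑ(p; w) = δ(w) p₂ - ρ(p) w₂`. [folklore] -/
noncomputable def zHat (μ : K) : MvPolynomial (Fin 3) (MvPolynomial (Fin 3) K) :=
  deltaForm μ * C (X 2) - C (rhoPoly μ) * X 2

/-- `δ` is a form of degree one in `w`. [folklore] -/
theorem isHomogeneous_deltaForm (μ : K) : (deltaForm μ).IsHomogeneous 1 :=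
  (isHomogeneous_X _ _).sub (isHomogeneous_C_mul_X _ _)

/-- `x̂` is a form of degree one in `w`. [folklore] -/
theorem isHomogeneous_xHat (μ : K) : (xHat μ).IsHomogeneous 1 := by
  have h1 := (isHomogeneous_deltaForm μ).mul (isHomogeneous_C (σ := Fin 3) (X 0 :
    MvPolynomial (Fin 3) K))
  exact h1.sub (isHomogeneous_C_mul_X _ _)

/-- `ẑ` is a form of degree one in `w`. [folklore] -/
theorem isHomogeneous_zHat (μ : K) : (zHat μ).IsHomogeneous 1 := by
  have h1 := (isHomogeneous_deltaForm μ).mul (isHomogeneous_C (σ := Fin 3) (X 2 :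
    MvPolynomial (Fin 3) K))
  exact h1.sub (isHomogeneous_C_mul_X _ _)

/-- **The incidence form** `G_μ(p; w) = Σ_e c_e μ^{e₁} x̂^{e₀+e₁-k} ẑ^{e₂} δ^{N-(e₀+e₁-k)-e₂}`,
`N = d - k`: for `δ(w) ≠ 0` it is `δᴺ R_μ` evaluated at the (plane coordinates of the) point
where the line `{p + t w}` meets the plane `Π_μ = {x₁ = μ x₀}`. [folklore] -/
noncomputable def crossForm (f : MvPolynomial (Fin 3) K) (k N : ℕ) (μ : K) :
    MvPolynomial (Fin 3) (MvPolynomial (Fin 3) K) :=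
  ∑ e ∈ f.support, C (C (coeff e f * μ ^ (e 1))) * xHat μ ^ (e 0 + e 1 - k) * zHat μ ^ (e 2) *
    deltaForm μ ^ (N - (e 0 + e 1 - k) - e 2)

/-- `G_μ` is a form of degree `N` in `w` (when `N ≥ e₀ + e₁ - k + e₂` for all monomials).
[folklore] -/
theorem isHomogeneous_crossForm (f : MvPolynomial (Fin 3) K) {k N : ℕ} (μ : K)
    (hN : ∀ e ∈ f.support, e 0 + e 1 - k + e 2 ≤ N) : (crossForm f k N μ).IsHomogeneous N := by
  refine IsHomogeneous.sum _ _ _ fun e he => ?_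
  have h := (((isHomogeneous_C (σ := Fin 3) (C (coeff e f * μ ^ (e 1)) :
    MvPolynomial (Fin 3) K)).mul ((isHomogeneous_xHat μ).pow (e 0 + e 1 - k))).mul
    ((isHomogeneous_zHat μ).pow (e 2))).mul ((isHomogeneous_deltaForm μ).pow
      (N - (e 0 + e 1 - k) - e 2))
  have := hN e he
  convert h using 1
  simp only [one_mul, zero_add]
  omega

variable (μ : K) (p w : Fin 3 → K)

/-- Evaluation of `δ`. [folklore] -/
@[simp] theorem eval_map_deltaForm : eval w (map (eval p) (deltaForm μ)) = w 1 - μ * w 0 := by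
  simp [deltaForm]

/-- Evaluation of `x̂`. [folklore] -/
@[simp] theorem eval_map_xHat :
    eval w (map (eval p) (xHat μ)) = (w 1 - μ * w 0) * p 0 - (p 1 - μ * p 0) * w 0 := by
  simp [xHat, deltaForm, rhoPoly]

/-- Evaluation of `ẑ`. [folklore] -/
@[simp] theorem eval_map_zHat :
    eval w (map (eval p) (zHat μ)) = (w 1 - μ * w 0) * p 2 - (p 1 - μ * p 0) * w 2 := by
  simp [zHat, deltaForm, rhoPoly]

/-- Evaluation of `G_μ`. [folklore] -/
theorem eval_map_crossForm (f : MvPolynomial (Fin 3) K) (k N : ℕ) :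
    eval w (map (eval p) (crossForm f k N μ)) = ∑ e ∈ f.support, coeff e f * μ ^ (e 1) *
      ((w 1 - μ * w 0) * p 0 - (p 1 - μ * p 0) * w 0) ^ (e 0 + e 1 - k) *
      ((w 1 - μ * w 0) * p 2 - (p 1 - μ * p 0) * w 2) ^ (e 2) *
      (w 1 - μ * w 0) ^ (N - (e 0 + e 1 - k) - e 2) := by
  rw [crossForm, map_sum, map_sum]
  refine Finset.sum_congr rfl fun e _ => ?_
  simp only [map_mul, map_pow, map_C, eval_C, eval_map_xHat, eval_map_zHat, eval_map_deltaForm]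

variable {μ p w}

/-- A bookkeeping identity: `δᴺ (x/δ)ᵃ (z/δ)ᵇ = xᵃ zᵇ δ^{N-a-b}`. [folklore] -/
theorem pow_mul_div_pow_mul_div_pow {δ x z : K} (hδ : δ ≠ 0) {a b N : ℕ} (h : a + b ≤ N) :
    δ ^ N * ((x / δ) ^ a * (z / δ) ^ b) = x ^ a * z ^ b * δ ^ (N - a - b) := by
  rw [div_pow, div_pow]
  field_simp
  rw [show N = (N - a - b) + a + b by omega, pow_add, pow_add]
  simp only [show N - a - b + a + b - a - b = N - a - b by omega]
  ring

/-- **`G_μ` at a line transversal to `Π_μ`**: if `δ(w) ≠ 0` then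
`G_μ(p; w) = δ(w)ᴺ · R_μ(x̂/δ, ẑ/δ)`, where `(x̂/δ, μ x̂/δ, ẑ/δ) = p + t* w` is the point of the
line `{p + t w}` on `Π_μ`. [folklore] -/
theorem eval_map_crossForm_of_ne {f : MvPolynomial (Fin 3) K} {k N : ℕ}
    (hN : ∀ e ∈ f.support, e 0 + e 1 - k + e 2 ≤ N) (hδ : w 1 - μ * w 0 ≠ 0) :
    eval w (map (eval p) (crossForm f k N μ)) = (w 1 - μ * w 0) ^ N *
      eval ![((w 1 - μ * w 0) * p 0 - (p 1 - μ * p 0) * w 0) / (w 1 - μ * w 0),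
        ((w 1 - μ * w 0) * p 2 - (p 1 - μ * p 0) * w 2) / (w 1 - μ * w 0)] (resid f k μ) := by
  rw [eval_map_crossForm, resid, map_sum, Finset.mul_sum]
  refine Finset.sum_congr rfl fun e he => ?_
  simp only [map_mul, map_pow, eval_C, eval_X, Matrix.cons_val_zero, Matrix.cons_val_one]
  rw [show ∀ A B C : K, (w 1 - μ * w 0) ^ N * (A * B * C) = A * ((w 1 - μ * w 0) ^ N * (B * C))
    from fun A B C => by ring, pow_mul_div_pow_mul_div_pow hδ (hN e he)]
  ring

/-- The point where `{p + t w}` meets `Π_μ` (for `δ(w) ≠ 0`): with `t* = -ρ(p)/δ(w)`,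
`p + t* w = (x̂/δ, μ x̂/δ, ẑ/δ)`. [folklore] -/
theorem add_smul_eq_meet (hδ : w 1 - μ * w 0 ≠ 0) :
    p + (-(p 1 - μ * p 0) / (w 1 - μ * w 0)) • w =
      ![((w 1 - μ * w 0) * p 0 - (p 1 - μ * p 0) * w 0) / (w 1 - μ * w 0),
        μ * (((w 1 - μ * w 0) * p 0 - (p 1 - μ * p 0) * w 0) / (w 1 - μ * w 0)),
        ((w 1 - μ * w 0) * p 2 - (p 1 - μ * p 0) * w 2) / (w 1 - μ * w 0)] := by
  funext i
  fin_cases i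
  · simp only [Pi.add_apply, Pi.smul_apply, smul_eq_mul, Fin.zero_eta, Matrix.cons_val_zero]
    field_simp
    ring
  · simp only [Pi.add_apply, Pi.smul_apply, smul_eq_mul, Fin.mk_one, Matrix.cons_val_one,
      Matrix.cons_val_zero]
    field_simp
    ring
  · simp
    field_simp
    ring

/-- **`G_μ` at a line parallel to `Π_μ`**: if `δ(w) = 0`, `N = d - k` and `k` is the axis order,
then `w₀ᵏ G_μ(p; w) = (-ρ(p))ᴺ f_d(w₀, μ w₀, w₂)` (`f_d` the top form of `f`). [folklore] -/
theorem pow_mul_eval_map_crossForm_of_eq {f : MvPolynomial (Fin 3) K} {k : ℕ}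
    (hk : ∀ e ∈ f.support, k ≤ e 0 + e 1) (hδ : w 1 - μ * w 0 = 0) :
    w 0 ^ k * eval w (map (eval p) (crossForm f k (f.totalDegree - k) μ)) =
      (-(p 1 - μ * p 0)) ^ (f.totalDegree - k) *
        eval ![w 0, μ * w 0, w 2] (homogeneousComponent f.totalDegree f) := by
  classical
  rw [eval_map_crossForm, homogeneousComponent_apply, map_sum, Finset.mul_sum, Finset.mul_sum,
    Finset.sum_filter]
  refine Finset.sum_congr rfl fun e he => ?_
  have hdeg : e.degree ≤ f.totalDegree := le_totalDegree he
  rw [finsuppDegree_fin_three] at hdeg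
  have hke := hk e he
  simp only [hδ, zero_mul, zero_sub]
  by_cases htop : e.degree = f.totalDegree
  · rw [if_pos htop]
    have htop' : e 0 + e 1 + e 2 = f.totalDegree := by rw [← finsuppDegree_fin_three]; exact htop
    have hexp : f.totalDegree - k - (e 0 + e 1 - k) - e 2 = 0 := by omega
    rw [hexp, pow_zero, mul_one, eval_monomial,
      Finsupp.prod_fintype _ _ (fun i => by rw [pow_zero]), Fin.prod_univ_three]
    simp only [Matrix.cons_val_zero, Matrix.cons_val_one, Matrix.cons_val]
    have h1 : w 0 ^ k * w 0 ^ (e 0 + e 1 - k) = w 0 ^ e 0 * w 0 ^ e 1 := by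
      rw [← pow_add, ← pow_add, Nat.add_sub_cancel' hke]
    have hρN : (-(p 1 - μ * p 0)) ^ (f.totalDegree - k) =
        (-(p 1 - μ * p 0)) ^ (e 0 + e 1 - k) * (-(p 1 - μ * p 0)) ^ (e 2) := by
      rw [← pow_add]; congr 1; omega
    rw [hρN, show -((p 1 - μ * p 0) * w 0) = w 0 * (-(p 1 - μ * p 0)) by ring,
      show -((p 1 - μ * p 0) * w 2) = w 2 * (-(p 1 - μ * p 0)) by ring, mul_pow, mul_pow,
      mul_pow μ (w 0)]
    linear_combination ((-(p 1 - μ * p 0)) ^ (e 0 + e 1 - k) * (-(p 1 - μ * p 0)) ^ e 2 *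
      coeff e f * μ ^ e 1 * w 2 ^ e 2) * h1
  · rw [if_neg htop]
    have htop' : e 0 + e 1 + e 2 ≠ f.totalDegree := by
      rw [← finsuppDegree_fin_three]; exact htop
    have hexp : f.totalDegree - k - (e 0 + e 1 - k) - e 2 ≠ 0 := by omega
    simp [zero_pow hexp]

end Axis

section Helpers

variable {K : Type*} [Field K]

/-- A zero of a non-zero polynomial is a zero of one of its irreducible factors. [folklore] -/
theorem exists_irreducible_dvd_eval_eq_zero {σ : Type*} {F : MvPolynomial σ K} (hF : F ≠ 0)
    {c : σ → K} (hc : eval c F = 0) :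
    ∃ g : MvPolynomial σ K, Irreducible g ∧ g ∣ F ∧ eval c g = 0 := by
  classical
  obtain ⟨u, hu⟩ := UniqueFactorizationMonoid.factors_prod hF
  have hprod : eval c (UniqueFactorizationMonoid.factors F).prod = 0 := by
    have h := congrArg (eval c) hu
    rw [map_mul, hc] at h
    have hunit : IsUnit (eval c (u : MvPolynomial σ K)) := (Units.isUnit u).map _
    exact (mul_eq_zero.1 h).resolve_right hunit.ne_zero
  rw [map_multiset_prod, Multiset.prod_eq_zero_iff, Multiset.mem_map] at hprod
  obtain ⟨g, hg, hg0⟩ := hprod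
  exact ⟨g, UniqueFactorizationMonoid.irreducible_of_factor g hg,
    UniqueFactorizationMonoid.dvd_of_mem_factors hg, hg0⟩

/-- The direction of a line of `{f = 0}` is a zero of the top form of `f` (`K` infinite).
[folklore] -/
theorem eval_homogeneousComponent_eq_zero_of_line [Infinite K] {σ : Type*} [Fintype σ]
    {f : MvPolynomial σ K} {a w : σ → K} (hline : ∀ t : K, eval (a + t • w) f = 0) :
    eval w (homogeneousComponent f.totalDegree f) = 0 := by
  have hP : aeval (fun i => Polynomial.C (a i) + Polynomial.C (w i) * Polynomial.X) f = 0 :=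
    Polynomial.funext fun t => by rw [eval_aeval_line, hline t, Polynomial.eval_zero]
  rw [← coeff_aeval_line_of_totalDegree_le f le_rfl a w, hP, Polynomial.coeff_zero]

/-- An irreducible plane curve over an algebraically closed field has infinitely many points.
[folklore] -/
theorem infinite_zeros_of_irreducible [IsAlgClosed K] {g : MvPolynomial (Fin 2) K}
    (hg : Irreducible g) : Set.Infinite {c : Fin 2 → K | eval c g = 0} := by
  classical
  haveI : Infinite K := IsAlgClosed.instInfinite
  set n := g.totalDegree with hn_def
  have hg0 : g ≠ 0 := hg.ne_zero
  have hn : n ≠ 0 := by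
    intro h0
    rw [hn_def, totalDegree_eq_zero_iff_eq_C] at h0
    apply hg.not_isUnit
    rw [h0]
    refine IsUnit.map C (isUnit_iff_ne_zero.2 fun hc => hg0 ?_)
    rw [h0, hc, map_zero]
  -- the top form is non-zero; pick `v` with `g_n(v) ≠ 0`
  have htop : homogeneousComponent n g ≠ 0 := by
    intro h0
    have hne : g.support.Nonempty := by
      rw [Finset.nonempty_iff_ne_empty, Ne, support_eq_empty]; exact hg0
    obtain ⟨e, he, hdeg⟩ := Finset.exists_mem_eq_sup g.support hne (fun s => s.sum fun _ k => k)
    have hdeg' : e.degree = n := by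
      rw [hn_def, totalDegree, hdeg]; rfl
    have := congrArg (coeff e) h0
    rw [coeff_homogeneousComponent, if_pos hdeg', coeff_zero] at this
    exact (mem_support_iff.1 he) this
  obtain ⟨v, hv⟩ := exists_eval_ne_zero htop
  have hv0 : v ≠ 0 := by
    rintro rfl
    apply hv
    have h := eval_smul_of_isHomogeneous (homogeneousComponent_isHomogeneous n g) (0 : K)
      (0 : Fin 2 → K)
    rw [zero_smul, zero_pow hn, zero_mul] at h
    exact h
  -- a transversal direction `e'`
  obtain ⟨e', hind⟩ : ∃ e' : Fin 2 → K, LinearIndependent K ![e', v] := by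
    by_cases h0 : v 0 = 0
    · have h1 : v 1 ≠ 0 := by
        intro h1; apply hv0; funext j; fin_cases j <;> assumption
      refine ⟨![1, 0], LinearIndependent.pair_iff.2 fun s t hst => ?_⟩
      have e0 := congrFun hst 0
      have e1 := congrFun hst 1
      simp [h0] at e0 e1
      exact ⟨e0, e1.resolve_right h1⟩
    · refine ⟨![0, 1], LinearIndependent.pair_iff.2 fun s t hst => ?_⟩
      have e0 := congrFun hst 0
      have e1 := congrFun hst 1
      simp at e0 e1
      rcases e0 with rfl | h
      · simp at e1; exact ⟨e1, rfl⟩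
      · exact absurd h h0
  -- on each line `s e' + t v` there is a zero
  have hroot : ∀ s : K, ∃ t : K, eval (s • e' + t • v) g = 0 := by
    intro s
    set P := aeval (fun i => Polynomial.C ((s • e') i) + Polynomial.C (v i) * Polynomial.X) g
      with hP
    have hPn : P.coeff n = eval v (homogeneousComponent n g) :=
      coeff_aeval_line_of_totalDegree_le g le_rfl _ _
    have hPdeg : P.degree ≠ 0 := by
      intro h0
      have h1 : P.natDegree = 0 := Polynomial.natDegree_eq_zero_iff_degree_le_zero.2 h0.le
      have hc : P.coeff n = 0 := Polynomial.coeff_eq_zero_of_natDegree_lt (by omega)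
      exact hv (hPn ▸ hc)
    obtain ⟨t, ht⟩ := IsAlgClosed.exists_root P hPdeg
    refine ⟨t, ?_⟩
    rwa [Polynomial.IsRoot.def, hP, eval_aeval_line] at ht
  choose t ht using hroot
  refine Set.infinite_of_injective_forall_mem (f := fun s : K => s • e' + t s • v) ?_ (fun s => ht s)
  intro s s' h
  have h2 : (s - s') • e' + (t s - t s') • v = 0 := by
    have h' : s • e' + t s • v - (s' • e' + t s' • v) = 0 := sub_eq_zero.2 h
    rw [← h', sub_smul, sub_smul]; abel
  have := (LinearIndependent.pair_iff.1 hind) _ _ h2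
  exact sub_eq_zero.1 this.1

/-- The coordinate plane `{x_i = a}`. [folklore] -/
def coordPlane (i : Fin 3) (a : K) : AffineSubspace K (Fin 3 → K) :=
  AffineSubspace.mk' (Pi.single i a) (LinearMap.ker (LinearMap.proj i))

/-- Membership in the coordinate plane. [folklore] -/
theorem mem_coordPlane {i : Fin 3} {a : K} {z : Fin 3 → K} : z ∈ coordPlane i a ↔ z i = a := by
  rw [coordPlane, AffineSubspace.mem_mk', LinearMap.mem_ker, LinearMap.proj_apply, vsub_eq_sub,
    Pi.sub_apply, Pi.single_eq_same, sub_eq_zero]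

/-- The coordinate plane has dimension two. [folklore] -/
theorem finrank_direction_coordPlane (i : Fin 3) (a : K) :
    Module.finrank K (coordPlane i a).direction = 2 := by
  rw [coordPlane, AffineSubspace.direction_mk']
  have h := LinearMap.finrank_range_add_finrank_ker (LinearMap.proj i : (Fin 3 → K) →ₗ[K] K)
  have hr : LinearMap.range (LinearMap.proj i : (Fin 3 → K) →ₗ[K] K) = ⊤ := by
    rw [LinearMap.range_eq_top]
    intro x
    exact ⟨Pi.single i x, by simp⟩
  rw [hr, finrank_top, Module.finrank_self, Module.finrank_fin_fun] at h
  omega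

/-- A line containing two distinct points is the `lineOf` through them. [folklore] -/
theorem eq_lineOf_sub_of_mem {ℓ : AffineSubspace K (Fin 3 → K)}
    (hℓ : Module.finrank K ℓ.direction = 1) {y₁ y₂ : Fin 3 → K} (h₁ : y₁ ∈ ℓ) (h₂ : y₂ ∈ ℓ)
    (hne : y₁ ≠ y₂) : ℓ = lineOf y₁ (y₂ - y₁) := by
  obtain ⟨u, hu, rfl⟩ := exists_eq_lineOf_of_mem ℓ hℓ h₁
  obtain ⟨s, hs⟩ := mem_lineOf.1 h₂
  have hs0 : s ≠ 0 := by
    rintro rfl; rw [zero_smul, add_zero] at hs; exact hne hs.symm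
  rw [hs, add_sub_cancel_left, ← lineOf_add_smul_smul y₁ u 0 hs0, zero_smul, add_zero]

end Helpers

section KeyLemma

variable {K : Type*} [Field K]

/-- The embedding of `K²` as the coordinate plane `{x_i = a}`. [folklore] -/
def planeEmb (i : Fin 3) (a : K) (c : Fin 2 → K) : Fin 3 → K :=
  Fin.insertNth (α := fun _ => K) i a c

/-- The substitution realising the restriction of a polynomial to `{x_i = a}`. [folklore] -/
noncomputable def planeSubst (i : Fin 3) (a : K) : Fin 3 → MvPolynomial (Fin 2) K :=
  Fin.insertNth (α := fun _ => MvPolynomial (Fin 2) K) i (C a) (fun j => X j)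

/-- Evaluating a restriction is evaluating at the embedded point. [folklore] -/
theorem eval_aeval_planeSubst (i : Fin 3) (a : K) (c : Fin 2 → K) (g : MvPolynomial (Fin 3) K) :
    eval c (aeval (planeSubst i a) g) = eval (planeEmb i a c) g := by
  have key : (fun j => eval c (planeSubst i a j)) = planeEmb i a c := by
    funext j
    refine Fin.succAboveCases i ?_ (fun j' => ?_) j
    · simp [planeSubst, planeEmb, Fin.insertNth_apply_same]
    · simp [planeSubst, planeEmb, Fin.insertNth_apply_succAbove]
  rw [eval_aeval_eq_eval, key]

omit [Field K] in
/-- The `i`-th coordinate of an embedded point. [folklore] -/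
@[simp] theorem planeEmb_apply_same (i : Fin 3) (a : K) (c : Fin 2 → K) : planeEmb i a c i = a :=
  Fin.insertNth_apply_same (α := fun _ => K) i a c

omit [Field K] in
/-- The other coordinates of an embedded point. [folklore] -/
@[simp] theorem planeEmb_apply_succAbove (i : Fin 3) (a : K) (c : Fin 2 → K) (j : Fin 2) :
    planeEmb i a c (i.succAbove j) = c j :=
  Fin.insertNth_apply_succAbove (α := fun _ => K) i a c j

omit [Field K] in
/-- `planeEmb` is injective. [folklore] -/
theorem planeEmb_injective (i : Fin 3) (a : K) : Function.Injective (planeEmb i a) :=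
  Fin.insertNth_right_injective (α := fun _ => K) (p := i) a

omit [Field K] in
/-- A point with `x_i = a` is embedded. [folklore] -/
theorem planeEmb_removeNth {i : Fin 3} {a : K} {x : Fin 3 → K} (hx : x i = a) :
    planeEmb i a (Fin.removeNth i x) = x := by
  rw [planeEmb, ← hx]; exact Fin.insertNth_self_removeNth (α := fun _ => K) i x

/-- `planeEmb` is affine: `ι(c + t e) = ι c + t ŵ` with `ŵ` the embedded vector `e` (zero
`i`-th coordinate). [folklore] -/
theorem planeEmb_add_smul (i : Fin 3) (a : K) (c e : Fin 2 → K) (t : K) :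
    planeEmb i a (c + t • e) = planeEmb i a c + t • Fin.insertNth (α := fun _ => K) i (0 : K) e := by
  funext j
  refine Fin.succAboveCases i ?_ (fun j' => ?_) j
  · simp [planeEmb, Fin.insertNth_apply_same]
  · simp [planeEmb, Fin.insertNth_apply_succAbove]

/-- **Finiteness on one line**: an irreducible plane curve `{g₀ = 0}` in the coordinate plane
`{x_i = p₀ᵢ}` through the point `p₀` meets a line `m' ∌ p₀` of `K³` in finitely many (embedded)
points — otherwise `m'` lies in the plane and, by weak Bézout, `{g₀ = 0}` is that line, which
passes through `p₀`. [folklore] -/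
theorem finite_curve_points_on_line [IsAlgClosed K] {i : Fin 3} {p₀ : Fin 3 → K}
    {g₀ : MvPolynomial (Fin 2) K} (hg₀irr : Irreducible g₀)
    (hg₀c₀ : eval (Fin.removeNth i p₀) g₀ = 0)
    {m' : AffineSubspace K (Fin 3 → K)} (hm'1 : Module.finrank K m'.direction = 1)
    (hp₀m' : p₀ ∉ m') :
    Set.Finite {c : Fin 2 → K | eval c g₀ = 0 ∧ planeEmb i (p₀ i) c ∈ m'} := by
  by_contra hinf
  have hinf' : Set.Infinite {c : Fin 2 → K | eval c g₀ = 0 ∧ planeEmb i (p₀ i) c ∈ m'} := hinf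
  obtain ⟨c₁, hc₁, hc₁m⟩ := hinf'.nonempty
  obtain ⟨c₂, ⟨hc₂, hc₂m⟩, hne⟩ := hinf'.nontrivial.exists_ne c₁
  set ι := planeEmb i (p₀ i) with hι
  set e : Fin 2 → K := c₂ - c₁ with he
  have he0 : e ≠ 0 := fun h => hne (sub_eq_zero.1 h)
  -- `m'` is the embedded line through `c₁` with direction `e`
  have hy : ι c₁ ≠ ι c₂ := fun h => hne.symm (planeEmb_injective i _ h)
  have hm'eq : m' = lineOf (ι c₁) (ι c₂ - ι c₁) := eq_lineOf_sub_of_mem hm'1 hc₁m hc₂m hy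
  have hŵ : ι c₂ - ι c₁ = Fin.insertNth (α := fun _ => K) i (0 : K) e := by
    have h := planeEmb_add_smul i (p₀ i) c₁ e 1
    rw [one_smul, one_smul, he, add_sub_cancel] at h
    simp only [hι]
    rw [h, add_sub_cancel_left]
  -- points of the set lie on the plane line `c₁ + K e`, i.e. on the zero set of `Λ`
  set Λ : MvPolynomial (Fin 2) K := C (e 1) * (X 0 - C (c₁ 0)) - C (e 0) * (X 1 - C (c₁ 1))
    with hΛ
  have hΛline : ∀ c, ι c ∈ m' → eval c Λ = 0 := by
    intro c hc
    rw [hm'eq, hŵ] at hc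
    obtain ⟨t, ht⟩ := mem_lineOf.1 hc
    rw [← planeEmb_add_smul] at ht
    have hct : c = c₁ + t • e := planeEmb_injective i _ ht
    rw [hct, hΛ]
    simp
    ring
  have hinf2 : Set.Infinite {c : Fin 2 → K | eval c g₀ = 0 ∧ eval c Λ = 0} :=
    hinf'.mono fun c hc => ⟨hc.1, hΛline c hc.2⟩
  obtain ⟨r, hr⟩ := Literature.RingTheory.MvPolynomial.PlaneCurves.dvd_of_infinite_commonZeros
    hg₀irr hinf2
  -- so `Λ(c₀) = 0`: `c₀ = c₁ + t₀ e`, and `p₀ ∈ m'`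
  set c₀ := Fin.removeNth i p₀ with hc₀
  have hΛc₀ : eval c₀ Λ = 0 := by rw [hr, map_mul, hg₀c₀, zero_mul]
  have hrel : e 1 * (c₀ 0 - c₁ 0) - e 0 * (c₀ 1 - c₁ 1) = 0 := by
    rw [hΛ] at hΛc₀; simpa using hΛc₀
  obtain ⟨t₀, ht₀⟩ : ∃ t₀ : K, c₀ = c₁ + t₀ • e := by
    by_cases h0 : e 0 = 0
    · have h1 : e 1 ≠ 0 := by
        intro h1; apply he0; funext j; fin_cases j <;> assumption
      refine ⟨(c₀ 1 - c₁ 1) / e 1, ?_⟩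
      have h00 : c₀ 0 = c₁ 0 := by
        rw [h0, zero_mul, sub_zero] at hrel
        exact sub_eq_zero.1 ((mul_eq_zero.1 hrel).resolve_left h1)
      funext j; fin_cases j
      · simp [h0, h00]
      · simp only [Fin.mk_one, Pi.add_apply, Pi.smul_apply, smul_eq_mul]
        rw [div_mul_cancel₀ _ h1]; ring
    · refine ⟨(c₀ 0 - c₁ 0) / e 0, ?_⟩
      funext j; fin_cases j
      · simp only [Fin.zero_eta, Pi.add_apply, Pi.smul_apply, smul_eq_mul]
        rw [div_mul_cancel₀ _ h0]; ring
      · simp only [Fin.mk_one, Pi.add_apply, Pi.smul_apply, smul_eq_mul]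
        have h2 : (c₀ 0 - c₁ 0) / e 0 * e 1 = c₀ 1 - c₁ 1 := by
          rw [div_mul_eq_mul_div, div_eq_iff h0]; linear_combination hrel
        rw [h2]; ring
  apply hp₀m'
  rw [← planeEmb_removeNth (rfl : p₀ i = p₀ i), ← hc₀, ht₀, planeEmb_add_smul, ← hŵ, hm'eq]
  exact add_smul_mem_lineOf _ _ _

/-- **Key lemma, pointwise form** (Salmon's pencil argument at one crossing point). Let `f` be
irreducible of degree `d ≥ 2` over an algebraically closed field, every point of `S = {f = 0}`
lying on a line of `S`; let only finitely many lines of `S` be coplanar with the axis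
`ℓ₀ = {x₀ = x₁ = 0}`, and `k ≤ e₀ + e₁` for all monomials `x^e` of `f`. Let `m ⊂ S` be a line
coplanar with only finitely many lines of `S`, with direction transversal to the plane
`Π_μ = {x₁ = μ x₀}`, through the point `q = (0, 0, q₂)` of the axis. Then `φ_μ(q₂) = 0`.
[cite: GuthKatz2015, Lemma 3.4 (proof)] [cite: Kollar2015, Proposition 55 (5)] -/
theorem axisPoly_eval_eq_zero_of_crossing [IsAlgClosed K] {f : MvPolynomial (Fin 3) K}
    (hf : Irreducible f) (hd : 2 ≤ f.totalDegree)
    (hE : ∀ p : Fin 3 → K, eval p f = 0 → ∃ v : Fin 3 → K, v ≠ 0 ∧ ∀ t : K,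
      eval (p + t • v) f = 0)
    (hfin : Set.Finite {m | m ∈ linesOn f ∧ Copl (lineOf 0 (Pi.single 2 1)) m})
    {k : ℕ} (hk : ∀ e ∈ f.support, k ≤ e 0 + e 1)
    {μ : K} {m : AffineSubspace K (Fin 3 → K)} (hm : m ∈ linesOn f)
    (hmfin : Set.Finite {m' | m' ∈ linesOn f ∧ Copl m m'})
    (hmμ : ∀ u : Fin 3 → K, m.direction = K ∙ u → u ≠ 0 → u 1 - μ * u 0 ≠ 0)
    {q : Fin 3 → K} (hq0 : q 0 = 0) (hq1 : q 1 = 0) (hqm : q ∈ m) :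
    (axisPoly f k μ).eval (q 2) = 0 := by
  classical
  haveI : Infinite K := IsAlgClosed.instInfinite
  set ez : Fin 3 → K := Pi.single 2 1 with hez
  set ℓ₀ : AffineSubspace K (Fin 3 → K) := lineOf 0 ez with hℓ₀
  set d := f.totalDegree with hd_def
  have hN : ∀ e ∈ f.support, e 0 + e 1 - k + e 2 ≤ d - k := by
    intro e he
    have h1 := hk e he
    have h2 : e.degree ≤ d := le_totalDegree he
    rw [finsuppDegree_fin_three] at h2
    omega
  -- Step 1: the direction of `m` at `q`
  obtain ⟨u, hu0, hmq⟩ := exists_eq_lineOf_of_mem m hm.1 hqm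
  have hδu : u 1 - μ * u 0 ≠ 0 := hmμ u (by rw [hmq, direction_lineOf]) hu0
  -- Step 2: the finite set `B` of points of `m` on another line of `S`; a general point `p₀`
  set B : Set (Fin 3 → K) := {y | y ∈ m ∧ ∃ m' ∈ linesOn f, m' ≠ m ∧ y ∈ m'} with hB
  have hBfin : B.Finite := by
    refine Set.Finite.subset (Set.Finite.biUnion hmfin (t := fun m' =>
      {y : Fin 3 → K | y ∈ m ∧ y ∈ m' ∧ m' ≠ m}) fun m' hm' => ?_) ?_
    · refine Set.Subsingleton.finite fun y hy y' hy' => ?_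
      exact eq_of_mem_of_mem hm.1 hm'.1.1 hy.2.2.symm hy.1 hy.2.1 hy'.1 hy'.2.1
    · rintro y ⟨hym, m', hm', hne, hym'⟩
      exact Set.mem_biUnion (x := m') ⟨hm', Or.inl ⟨y, hym, hym'⟩⟩ ⟨hym, hym', hne⟩
  have hm_inf : (m : Set (Fin 3 → K)).Infinite := by
    have hinj : Function.Injective (fun t : K => q + t • u) := fun t t' h =>
      smul_left_injective K hu0 (add_left_cancel h)
    refine Set.infinite_of_injective_forall_mem hinj (fun t => ?_)
    show q + t • u ∈ (m : Set (Fin 3 → K))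
    rw [hmq]; exact add_smul_mem_lineOf q u t
  obtain ⟨p₀, hp₀m, hp₀notin⟩ := (hm_inf.sdiff (hBfin.union (Set.finite_singleton q))).nonempty
  have hp₀B : p₀ ∉ B := fun h => hp₀notin (Or.inl h)
  have hp₀f : eval p₀ f = 0 := hm.2 _ hp₀m
  have huniq : ∀ m' ∈ linesOn f, p₀ ∈ m' → m' = m := by
    intro m' hm' hp
    by_contra hne
    exact hp₀B ⟨hp₀m, m', hm', hne, hp⟩
  have hmp₀ : m = lineOf p₀ u := by
    have hp' : p₀ ∈ lineOf q u := hmq ▸ hp₀m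
    obtain ⟨s, hs⟩ := mem_lineOf.1 hp'
    rw [hmq, hs, ← lineOf_add_smul_smul q u s one_ne_zero, one_smul]
  -- Step 3: the coordinate plane through `p₀` transversal to `m`, the section and a component
  obtain ⟨i, hi⟩ : ∃ i, u i ≠ 0 := Function.ne_iff.1 hu0
  set ι := planeEmb i (p₀ i) with hι
  set fS : MvPolynomial (Fin 2) K := aeval (planeSubst i (p₀ i)) f with hfS_def
  have hfS0 : fS ≠ 0 := by
    obtain ⟨z, hz, hzf⟩ := exists_mem_eval_ne_zero_of_irreducible hf hd (coordPlane i (p₀ i))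
      (finrank_direction_coordPlane i (p₀ i))
    intro h0
    apply hzf
    rw [← planeEmb_removeNth (mem_coordPlane.1 hz), ← eval_aeval_planeSubst, ← hfS_def, h0,
      map_zero]
  set c₀ : Fin 2 → K := Fin.removeNth i p₀ with hc₀
  have hιc₀ : ι c₀ = p₀ := planeEmb_removeNth rfl
  have hfSc₀ : eval c₀ fS = 0 := by rw [hfS_def, eval_aeval_planeSubst, ← hι, hιc₀]; exact hp₀f
  obtain ⟨g₀, hg₀irr, hg₀dvd, hg₀c₀⟩ := exists_irreducible_dvd_eval_eq_zero hfS0 hfSc₀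
  have hY₀S : ∀ c, eval c g₀ = 0 → eval (ι c) f = 0 := by
    intro c hc
    obtain ⟨r, hr⟩ := hg₀dvd
    rw [hι, ← eval_aeval_planeSubst, ← hfS_def, hr, map_mul, hc, zero_mul]
  have hY₀inf : Set.Infinite {c : Fin 2 → K | eval c g₀ = 0} :=
    infinite_zeros_of_irreducible hg₀irr
  -- Step 4: the points of the component lying on a line of `S` coplanar with the axis: finite
  have hbad : Set.Finite {c : Fin 2 → K | eval c g₀ = 0 ∧
      ∃ m' ∈ linesOn f, Copl ℓ₀ m' ∧ ι c ∈ m'} := by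
    refine Set.Finite.subset (Set.Finite.biUnion hfin (t := fun m' =>
      {c : Fin 2 → K | eval c g₀ = 0 ∧ ι c ∈ m'}) fun m' hm' => ?_) ?_
    swap
    · rintro c ⟨hc, m', hm', hcop, hcm⟩
      exact Set.mem_biUnion (x := m') ⟨hm', hcop⟩ ⟨hc, hcm⟩
    by_cases hpm' : p₀ ∈ m'
    · -- then `m' = m`, which meets the plane only at `p₀`
      have hmm : m' = m := huniq m' hm'.1 hpm'
      refine Set.Finite.subset (Set.finite_singleton c₀) ?_
      rintro c ⟨-, hcm⟩
      rw [hmm, hmp₀] at hcm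
      obtain ⟨s, hs⟩ := mem_lineOf.1 hcm
      have hsi := congrFun hs i
      rw [hι, planeEmb_apply_same, Pi.add_apply, Pi.smul_apply, smul_eq_mul] at hsi
      have hs0 : s = 0 := by
        have : s * u i = 0 := by linear_combination -hsi
        exact (mul_eq_zero.1 this).resolve_right hi
      rw [hs0, zero_smul, add_zero] at hs
      exact planeEmb_injective i _ (hs.trans hιc₀.symm)
    · exact finite_curve_points_on_line hg₀irr hg₀c₀ hm'.1.1 hpm'
  -- Step 5: the family of forms and the common zeros at good points of the component
  set Gfam : Option (Fin d) → MvPolynomial (Fin 3) (MvPolynomial (Fin 3) K) :=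
    fun o => o.elim (crossForm f k (d - k) μ) (fun j => taylorForm f (j.1 + 1)) with hGfam
  set efam : Option (Fin d) → ℕ := fun o => o.elim (d - k) (fun j => j.1 + 1) with hefam
  have hGhom : ∀ o, (Gfam o).IsHomogeneous (efam o) := by
    rintro (_ | j)
    · exact isHomogeneous_crossForm f μ hN
    · exact isHomogeneous_taylorForm f _
  have hgood : ∀ c : Fin 2 → K, eval c g₀ = 0 →
      (¬ ∃ m' ∈ linesOn f, Copl ℓ₀ m' ∧ ι c ∈ m') → HasCommonZero Gfam (ι c) := by
    intro c hc hnot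
    have hxS := hY₀S c hc
    obtain ⟨w, hw0, hwline⟩ := hE (ι c) hxS
    have hr : lineOf (ι c) w ∈ linesOn f := (lineOf_mem_linesOn_iff _ hw0).2 hwline
    have hncop : ¬ Copl ℓ₀ (lineOf (ι c) w) := fun hcop =>
      hnot ⟨_, hr, hcop, self_mem_lineOf _ _⟩
    refine ⟨w, hw0, ?_⟩
    rintro (_ | j)
    · show eval w (map (eval (ι c)) (crossForm f k (d - k) μ)) = 0
      by_cases hδ : w 1 - μ * w 0 = 0
      · -- parallel to `Π_μ`: `w₀ ≠ 0` and the top form vanishes at `w`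
        have hw00 : w 0 ≠ 0 := by
          intro h00
          have h10 : w 1 = 0 := by rw [h00, mul_zero, sub_zero] at hδ; exact hδ
          apply hncop
          refine Or.inr ?_
          rw [hℓ₀, direction_lineOf, direction_lineOf, span_singleton_eq_iff hw0]
          refine ⟨w 2, ?_⟩
          funext j; fin_cases j <;> simp [hez, h00, h10]
        have hwv : (![w 0, μ * w 0, w 2] : Fin 3 → K) = w := by
          funext j; fin_cases j
          · rfl
          · show μ * w 0 = w 1; linear_combination -hδ
          · rfl
        have key := pow_mul_eval_map_crossForm_of_eq (p := ι c) (μ := μ) hk hδ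
        rw [hwv, eval_homogeneousComponent_eq_zero_of_line hwline, mul_zero] at key
        exact (mul_eq_zero.1 key).resolve_left (pow_ne_zero _ hw00)
      · rw [eval_map_crossForm_of_ne hN hδ]
        have hyeq := add_smul_eq_meet (p := ι c) (μ := μ) hδ
        have hyS : eval (ι c + (-((ι c) 1 - μ * (ι c) 0) / (w 1 - μ * w 0)) • w) f = 0 :=
          hwline _
        rw [hyeq] at hyS
        set A := ((w 1 - μ * w 0) * (ι c) 0 - ((ι c) 1 - μ * (ι c) 0) * w 0) / (w 1 - μ * w 0)
          with hA_def
        set Bz := ((w 1 - μ * w 0) * (ι c) 2 - ((ι c) 1 - μ * (ι c) 0) * w 2) / (w 1 - μ * w 0)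
          with hBz_def
        have hres : A ^ k * eval ![A, Bz] (resid f k μ) = 0 := by
          rw [pow_mul_eval_resid hk]; exact hyS
        have hA : A ≠ 0 := by
          intro hA0
          apply hncop
          refine Or.inl ⟨![A, μ * A, Bz], mem_lineOf.2 ⟨Bz, ?_⟩, ?_⟩
          · funext j; fin_cases j <;> simp [hez, hA0]
          · rw [← hyeq]; exact add_smul_mem_lineOf _ _ _
        rw [(mul_eq_zero.1 hres).resolve_left (pow_ne_zero _ hA), mul_zero]
    · show eval w (map (eval (ι c)) (taylorForm f (j.1 + 1))) = 0
      exact (forall_eval_add_smul_iff f hxS w).1 hwline _ (Nat.succ_pos _) j.2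
  -- Step 6: elimination at `p₀`: the forms have a common zero there
  have hcz : HasCommonZero Gfam p₀ := by
    by_contra h0
    obtain ⟨Δ, hΔp₀, hΔ⟩ := exists_eval_ne_zero_not_hasCommonZero Gfam efam hGhom h0
    set ΔS : MvPolynomial (Fin 2) K := aeval (planeSubst i (p₀ i)) Δ with hΔS
    have hinf2 : Set.Infinite {c : Fin 2 → K | eval c g₀ = 0 ∧ eval c ΔS = 0} := by
      refine (hY₀inf.sdiff hbad).mono ?_
      rintro c ⟨hc, hnb⟩
      refine ⟨hc, ?_⟩
      have hgoodc := hgood c hc (fun h => hnb ⟨hc, h⟩)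
      by_contra hne
      rw [hΔS, eval_aeval_planeSubst] at hne
      exact hΔ _ hne hgoodc
    obtain ⟨r, hr⟩ := Literature.RingTheory.MvPolynomial.PlaneCurves.dvd_of_infinite_commonZeros
      hg₀irr hinf2
    apply hΔp₀
    rw [← hιc₀, hι, ← eval_aeval_planeSubst, ← hΔS, hr, map_mul, hg₀c₀, zero_mul]
  -- Step 7: that common zero is the direction of `m`
  obtain ⟨w₀, hw₀0, hw₀⟩ := hcz
  have hline₀ : ∀ t : K, eval (p₀ + t • w₀) f = 0 := by
    refine (forall_eval_add_smul_iff f hp₀f w₀).2 fun i1 hi1 hid => ?_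
    have h := hw₀ (some ⟨i1 - 1, by omega⟩)
    simp only [hGfam, Option.elim] at h
    rwa [Nat.sub_add_cancel hi1] at h
  have hm' : lineOf p₀ w₀ = m :=
    huniq _ ((lineOf_mem_linesOn_iff p₀ hw₀0).2 hline₀) (self_mem_lineOf _ _)
  have hdir : (K ∙ u) = (K ∙ w₀) := by
    rw [← direction_lineOf p₀ u, ← direction_lineOf p₀ w₀, hm', hmp₀]
  obtain ⟨cst, hcst⟩ := (span_singleton_eq_iff hw₀0).1 hdir
  have hcst0 : cst ≠ 0 := by
    rintro rfl; rw [zero_smul] at hcst; exact hw₀0 hcst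
  have hGu : eval u (map (eval p₀) (crossForm f k (d - k) μ)) = 0 := by
    have h := hw₀ none
    simp only [hGfam, Option.elim] at h
    rw [hcst, eval_smul_of_isHomogeneous ((isHomogeneous_crossForm f μ hN).map _)] at h
    exact (mul_eq_zero.1 h).resolve_left (pow_ne_zero _ hcst0)
  -- Step 8: unfold `G_μ(p₀; u) = 0`: the point of `m` on `Π_μ` is `q`
  rw [eval_map_crossForm_of_ne hN hδu] at hGu
  have hGu' := (mul_eq_zero.1 hGu).resolve_left (pow_ne_zero _ hδu)
  obtain ⟨s, hs⟩ := mem_lineOf.1 (show q ∈ lineOf p₀ u from hmp₀ ▸ hqm)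
  have h0 := congrFun hs 0
  have h1 := congrFun hs 1
  simp only [Pi.add_apply, Pi.smul_apply, smul_eq_mul] at h0 h1
  rw [hq0] at h0
  rw [hq1] at h1
  have hst : s = -(p₀ 1 - μ * p₀ 0) / (u 1 - μ * u 0) := by
    field_simp
    linear_combination μ * h0 - h1
  have hmeet := add_smul_eq_meet (p := p₀) (w := u) (μ := μ) hδu
  rw [← hst, ← hs] at hmeet
  have hA0 : ((u 1 - μ * u 0) * p₀ 0 - (p₀ 1 - μ * p₀ 0) * u 0) / (u 1 - μ * u 0) = 0 := by
    have := congrFun hmeet 0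
    simp only [Matrix.cons_val_zero] at this
    rw [← this, hq0]
  have hB : ((u 1 - μ * u 0) * p₀ 2 - (p₀ 1 - μ * p₀ 0) * u 2) / (u 1 - μ * u 0) = q 2 := by
    have := congrFun hmeet 2
    exact this.symm
  rw [hA0, hB, eval_resid_axis hk] at hGu'
  exact hGu'

/-- **Key lemma** (at most `d - 1` crossing points on a non-special line; Salmon Art. 485,
Guth–Katz Lemma 3.4, Kollár Prop. 55 (5), elementary form). Let `f` be irreducible of degree
`d ≥ 2` over an algebraically closed field, `S = {f = 0}` not a cylinder, every point of `S` on a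
line of `S`. If the axis `ℓ₀ = {x₀ = x₁ = 0}` lies on `S` and is coplanar with only finitely many
lines of `S`, then any finite set of points of `ℓ₀`, each lying on another line of `S` that is
itself coplanar with only finitely many lines of `S`, has at most `d - 1` elements.
[cite: GuthKatz2015, Lemma 3.4] [cite: Kollar2015, Proposition 55 (5)] -/
theorem card_crossing_le_of_axis [IsAlgClosed K] {f : MvPolynomial (Fin 3) K}
    (hf : Irreducible f) (hd : 2 ≤ f.totalDegree)
    (hcyl : ¬ ∃ v : Fin 3 → K, v ≠ 0 ∧ ∀ (p : Fin 3 → K) (t : K),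
      eval (p + t • v) f = eval p f)
    (hE : ∀ p : Fin 3 → K, eval p f = 0 → ∃ v : Fin 3 → K, v ≠ 0 ∧ ∀ t : K,
      eval (p + t • v) f = 0)
    (haxis : lineOf 0 (Pi.single 2 1) ∈ linesOn f)
    (hfin : Set.Finite {m | m ∈ linesOn f ∧ Copl (lineOf 0 (Pi.single 2 1)) m})
    (P : Finset (Fin 3 → K))
    (hP : ∀ q ∈ P, q ∈ lineOf (0 : Fin 3 → K) (Pi.single 2 1) ∧ ∃ m ∈ linesOn f,
      m ≠ lineOf 0 (Pi.single 2 1) ∧ q ∈ m ∧ Set.Finite {m' | m' ∈ linesOn f ∧ Copl m m'}) :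
    P.card + 1 ≤ f.totalDegree := by
  classical
  haveI : Infinite K := IsAlgClosed.instInfinite
  set ez : Fin 3 → K := Pi.single 2 1 with hez
  have hez0 : ez ≠ 0 := by simp [hez]
  set d := f.totalDegree with hd_def
  set k := axisOrd f with hk_def
  have hf0 : f ≠ 0 := hf.ne_zero
  have hk : ∀ e ∈ f.support, k ≤ e 0 + e 1 := fun e he => axisOrd_le he
  -- `1 ≤ k ≤ d - 1`
  have hk1 : 1 ≤ k := by
    refine one_le_axisOrd hf0 fun t => haxis.2 _ (mem_lineOf.2 ⟨t, ?_⟩)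
    rw [zero_add, hez, ← Pi.single_smul', smul_eq_mul, mul_one]
  have hkd : k + 1 ≤ d := by
    by_contra h
    exact hcyl ⟨ez, hez0, fun p t =>
      eval_add_smul_single_of_totalDegree_le_axisOrd (by omega) p t⟩
  -- the data of the points: directions of the crossing lines
  have hdat : ∀ q ∈ P, ∃ u : Fin 3 → K, u ≠ 0 ∧ ∃ m ∈ linesOn f, m = lineOf q u ∧
      m ≠ lineOf 0 ez ∧ Set.Finite {m' | m' ∈ linesOn f ∧ Copl m m'} := by
    intro q hq
    obtain ⟨-, m, hm, hmne, hqm, hmfin⟩ := hP q hq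
    obtain ⟨u, hu0, hmq⟩ := exists_eq_lineOf_of_mem m hm.1 hqm
    exact ⟨u, hu0, m, hm, hmq, hmne, hmfin⟩
  choose! u hu0 m hm hmq hmne hmfin using hdat
  -- a monomial of axis order `k`, and the finitely many bad slopes `μ`
  obtain ⟨e, he, hek⟩ := exists_mem_support_eq_axisOrd hf0
  set bad : Finset K := (axisCoeffPoly f k (e 2)).roots.toFinset ∪
    P.image (fun q => u q 1 / u q 0) with hbad
  obtain ⟨μ, hμ⟩ := Infinite.exists_notMem_finset bad
  have hμ1 : ¬ (axisCoeffPoly f k (e 2)).IsRoot μ := by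
    intro h
    apply hμ
    rw [hbad, Finset.mem_union, Multiset.mem_toFinset, Polynomial.mem_roots
      (axisCoeffPoly_ne_zero he hek)]
    exact Or.inl h
  have hμ2 : ∀ q ∈ P, u q 1 - μ * u q 0 ≠ 0 := by
    intro q hq h0
    by_cases hu00 : u q 0 = 0
    · have hu1 : u q 1 = 0 := by rw [hu00, mul_zero, sub_zero] at h0; exact h0
      apply hmne q hq
      rw [hmq q hq]
      symm
      refine AffineSubspace.ext_of_direction_eq ?_ ⟨q, (hP q hq).1, self_mem_lineOf _ _⟩
      rw [direction_lineOf, direction_lineOf, span_singleton_eq_iff (hu0 q hq)]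
      refine ⟨u q 2, ?_⟩
      funext j; fin_cases j <;> simp [hez, hu00, hu1]
    · apply hμ
      rw [hbad, Finset.mem_union]
      refine Or.inr (Finset.mem_image.2 ⟨q, hq, ?_⟩)
      field_simp
      linear_combination h0
  -- every point of `P` is a root of `φ_μ`
  have hne0 : axisPoly f k μ ≠ 0 := axisPoly_ne_zero hμ1
  have hroot : ∀ q ∈ P, q 2 ∈ (axisPoly f k μ).roots.toFinset := by
    intro q hq
    obtain ⟨t, ht⟩ := mem_lineOf.1 (hP q hq).1
    have hq0 : q 0 = 0 := by rw [ht]; simp [hez]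
    have hq1 : q 1 = 0 := by rw [ht]; simp [hez]
    rw [Multiset.mem_toFinset, Polynomial.mem_roots hne0, Polynomial.IsRoot.def]
    refine axisPoly_eval_eq_zero_of_crossing hf hd hE hfin hk (hm q hq) (hmfin q hq)
      (fun u' hu' hu'0 => ?_) hq0 hq1 (by rw [hmq q hq]; exact self_mem_lineOf _ _)
    -- any direction vector of `m q` is a non-zero multiple of `u q`
    rw [hmq q hq, direction_lineOf, span_singleton_eq_iff hu'0] at hu'
    obtain ⟨c, rfl⟩ := hu'
    have hc0 : c ≠ 0 := by rintro rfl; rw [zero_smul] at hu'0; exact hu'0 rfl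
    simp only [Pi.smul_apply, smul_eq_mul]
    have := hμ2 q hq
    intro h
    apply this
    have : c * (u q 1 - μ * u q 0) = 0 := by linear_combination h
    exact (mul_eq_zero.1 this).resolve_left hc0
  -- counting: `q ↦ q₂` is injective on `P`
  have hinj : Set.InjOn (fun q : Fin 3 → K => q 2) P := by
    intro q hq q' hq' h
    obtain ⟨t, ht⟩ := mem_lineOf.1 (hP q hq).1
    obtain ⟨t', ht'⟩ := mem_lineOf.1 (hP q' hq').1
    simp only at h
    rw [ht, ht'] at h ⊢
    simp [hez] at h
    rw [h]
  have hsub : (P.image fun q => q 2) ⊆ (axisPoly f k μ).roots.toFinset := fun z hz => by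
    obtain ⟨q, hq, rfl⟩ := Finset.mem_image.1 hz
    exact hroot q hq
  have h1 : P.card = (P.image fun q => q 2).card := (Finset.card_image_of_injOn hinj).symm
  have h2 := Finset.card_le_card hsub
  have h3 : (axisPoly f k μ).roots.toFinset.card ≤ (axisPoly f k μ).natDegree :=
    (Multiset.toFinset_card_le _).trans (Polynomial.card_roots' _)
  have h4 := natDegree_axisPoly_le f k μ
  omega

end KeyLemma

end Literature.Combinatorics.Extremal
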